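import Mathlib
import Summits.QuantumFields.YangMills.Theorems.BalabanUVNodesK2NamedJetsRemAt
import Summits.QuantumFields.YangMills.Theorems.BalabanUVNodesK2JsOfRecord
import Summits.QuantumFields.BalabanUV.Gaps.EndSurvivorCensus
import Summits.QuantumFields.YangMills.Theses.BalabanUVNodes

/-!
# IDEA-5 g3 (obstruction-first, round 3) — GAUGE-SLOT ∕ IR PROBE of the K2⁷ letters, and the RUN-KEYED modulus letter (card ed. 2.2)

HONEST FRAMING. Nothing here proves the Clay Yang–Mills mass gap or any rung of it; R4 closes only the CONDITIONAL finite-𝕋⁴ rung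
`BalabanLadder.UV`; [I] = Bałaban CMP 109 Thm 2 ∕ (0.31) p. 259 is unproved in print; K2⁷ `EndpointGivenBR13SepCoPH` stays OPEN.  Every
theorem below is elementary bookkeeping (real analysis on letters); the content is WHICH letters it exposes.

THE FINDING (NOTES.md ## F1, barrier note BN-F).  By the typing of the record (`effActionHT … = printedSeq …`, `printedSeq_zero = wilsonTerm (g 0)`,
`printedSeq_succ = nextAction (T k) (χ k) (GF k) (g k) A_k`, `integrand χ GF gk A U = χ U * exp (−(1/gk²)·GF U + A U)`, `chiFixed29_flowBlind`):
the history entry `p 0` is the BARE coupling and the entries `p 1, …, p k` enter `β_{k+1}(p)` ONLY as the gauge-fixing weights `1/(p j)²`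
(`fp016_of_fineInvariant`: they would drop out exactly for a fine-gauge-invariant density; the (2.9) window `χ₂₉` is not one).  Hence
* §1 LAST-SLOT-KEYED letters (`BoxRemainder`'s `≤ Cr·p(last)`, the modulus letter `≤ ω(p(last))` of this seat's ed. 2.1 `ModPkgAt`) PIN the
  sharp-gauge limit `g_k → 0⁺` of `β_{k+1}` to the named number AT EVERY PREFIX, i.e. at every bare coupling (`lastSlot_tendsto_of_modulusLetter`,
  `limUnder_lastSlot_eq`): a rigidity in the bare coupling, not print's (2.13) (which is read along runs, where the last slot IS the true coupling);
* §2 BOX-WIDE ∀k letters at a fixed level `γ₀` contain the constant history `constHist γ₀ k ∈ HistBox γ₀ k` for EVERY `k` — the honest flow from the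
  FIXED bare coupling `γ₀` at all scales; with the (D1) drift they force `Σ_{j<k} β_{j+1}(γ₀,…,γ₀) ≥ (slope − s)·k − A → +∞`
  (`sum_constHist_ge_of_constRemainder_drift`, `tendsto_sum_constHist_atTop`): one-loop running FOREVER from a fixed bare coupling, past its
  exit scale — an infrared statement no UV technology supplies ([I] Thm 3 p. 264 speaks of in-window run prefixes only);
* §3 THE UV-ADMISSIBLE RE-KEYING (this seat's card `convex-fibre-witten-modulus-kappa3`, edition 2.2): the modulus letter read on IN-WINDOW RUN
  PREFIXES (last slot = true coupling) with (C)∕(U) on the Gaps SURVIVOR SETS, `ModPkgOnRuns`; with the (D1) drift of the named numbers it gives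
  run-wise (PS) (`runwisePS_of_drift_modOnRuns`) and END of the record datum through the tree's
  `Gaps.EndSurvivorCensus.endpointExistence_datum_of_survivorLetters_runwisePS` BY NAME (`endpoint_of_drift_modPkgOnRuns`), and the crux decl
  BY NAME from the two re-keyed stub texts (`EndpointGivenBR13SepCoPH_of_line1ModRuns`).  rc 0 · 0 sorry intended.
-/

noncomputable section

namespace Summit.QuantumFields.YangMills.Cruxes.EndpointGivenBR13SepCoPH.Idea5GaugeSlot

open Filter Topology
open scoped BigOperators
open Literature.MathematicalPhysics.QuantumFieldTheory.Balaban1983to89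
open Literature.MathematicalPhysics.QuantumFieldTheory.Balaban1983to89.FlowStep
open Literature.MathematicalPhysics.QuantumFieldTheory.Balaban1983to89.DagBinding (EndpointExistence)
open Literature.MathematicalPhysics.QuantumFieldTheory.Balaban1983to89.T4Continuum (T4Family)
open Literature.MathematicalPhysics.QuantumFieldTheory.Balaban1983to89.B12Beta (HistBox)
open Literature.MathematicalPhysics.QuantumFieldTheory.Balaban1983to89.Beta.Drift (OneLoopDrift sum_Ico_ge_of_drift)
open Summit.QuantumFields.YangMills.Theorems.BalabanUVNodesK2JsOfRecord (StepColourData beta0OfJs BoxRemainder)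
open Summit.QuantumFields.YangMills.Theorems.BalabanUVNodesK2NamedJetsRemAt (ConstRemainder)
open Summit.QuantumFields.BalabanUV.Gaps.EndSurvivorCensus (endpointExistence_datum_of_survivorLetters_runwisePS)

/-! ## §0 Two elementary helpers -/

/-- From `ω → 0` as `t → 0⁺`: some `u > 0` with `ω < ε` on `]0, u[`. [folklore] -/
theorem exists_Ioo_of_tendsto {ω : ℝ → ℝ} (hω : Tendsto ω (𝓝[>] 0) (𝓝 0)) {ε : ℝ} (hε : 0 < ε) :
    ∃ u : ℝ, 0 < u ∧ ∀ t : ℝ, 0 < t → t < u → ω t < ε := by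
  have hmem : ω ⁻¹' Set.Iio ε ∈ 𝓝[>] (0 : ℝ) := hω (Iio_mem_nhds hε)
  obtain ⟨u, hu, hsub⟩ := mem_nhdsGT_iff_exists_Ioo_subset.mp hmem
  exact ⟨u, hu, fun t ht htu => hsub ⟨ht, htu⟩⟩

/-- `Step.InInterval` is monotone in the level. [folklore] -/
theorem inInterval_mono {γ γ' : ℝ} {n : ℕ} {gs : ℕ → ℝ} (h : Step.InInterval γ n gs) (hle : γ ≤ γ') :
    Step.InInterval γ' n gs := fun k hk => ⟨(h k hk).1, (h k hk).2.trans hle⟩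

/-! ## §1 Last-slot-keyed letters pin the sharp-gauge limit at EVERY prefix (every bare coupling) -/

/-- HYPOTHESIS SHAPE: a LAST-SLOT-KEYED remainder letter on the box `]0,γ₀]^{k+1}` — `|β_{k+1}(p) − b_k| ≤ ω(p_k)` for every `k` and every
box history, `ω → 0` at `0⁺`.  Instances: `BoxRemainder β b Cr γ₀` (`ω t = Cr·t`), this seat's ed. 2.1 `ModPkgAt` clause (b). [folklore] -/
def LastSlotLetter (β : HBeta) (b : ℕ → ℝ) (ω : ℝ → ℝ) (γ₀ : ℝ) : Prop :=
  ∀ (k : ℕ) (p : Fin (k + 1) → ℝ), p ∈ HistBox γ₀ k → |β k p - b k| ≤ ω (p (Fin.last k))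

/-- `BoxRemainder` is the linear instance. [folklore] -/
theorem lastSlotLetter_of_boxRemainder {β : HBeta} {b : ℕ → ℝ} {Cr γ₀ : ℝ} (h : BoxRemainder β b Cr γ₀) :
    LastSlotLetter β b (fun t => Cr * t) γ₀ := h

/-- The linear modulus tends to `0` at `0⁺`. [folklore] -/
theorem tendsto_linear_nhdsGT (Cr : ℝ) : Tendsto (fun t : ℝ => Cr * t) (𝓝[>] 0) (𝓝 0) := by
  have h : Tendsto (fun t : ℝ => Cr * t) (𝓝 0) (𝓝 (Cr * 0)) := (continuous_const.mul continuous_id).tendsto 0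
  rw [mul_zero] at h
  exact h.mono_left nhdsWithin_le_nhds

/-- **RIGIDITY DISPLAY.**  Under a last-slot letter, at EVERY prefix `q` with entries in `]0,γ₀]` off the last slot — in particular at every bare
coupling `q 0` — the last-slot limit `g_k → 0⁺` of `β_{k+1}` exists and EQUALS the named number `b_k`: the letter pins the sharp-gauge β to `b_k`
uniformly in the bare coupling (print's (2.13) p. 268 pins it only along runs, where the last slot is the true coupling). [cite: Balaban1987RG1, (2.13) p.268 and Thm 3 p.264] -/
theorem lastSlot_tendsto_of_modulusLetter {β : HBeta} {b : ℕ → ℝ} {ω : ℝ → ℝ} {γ₀ : ℝ} (hγ₀ : 0 < γ₀)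
    (hω : Tendsto ω (𝓝[>] 0) (𝓝 0)) (h : LastSlotLetter β b ω γ₀) (k : ℕ) (q : Fin (k + 1) → ℝ)
    (hq : ∀ i : Fin (k + 1), i ≠ Fin.last k → 0 < q i ∧ q i ≤ γ₀) :
    Tendsto (fun t : ℝ => β k (Function.update q (Fin.last k) t)) (𝓝[>] 0) (𝓝 (b k)) := by
  rw [tendsto_iff_norm_sub_tendsto_zero]
  have hIoc : Set.Ioc (0 : ℝ) γ₀ ∈ 𝓝[>] (0 : ℝ) := Ioc_mem_nhdsGT hγ₀
  refine squeeze_zero' (Eventually.of_forall fun t => norm_nonneg _) ?_ hω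
  filter_upwards [hIoc] with t ht
  have hmem : Function.update q (Fin.last k) t ∈ HistBox γ₀ k := by
    intro i
    by_cases hi : i = Fin.last k
    · subst hi; simpa using ht
    · simpa [Function.update_of_ne hi] using hq i hi
  have := h k _ hmem
  simpa [Real.norm_eq_abs] using this

/-- … hence the `limUnder` over the last slot (the shape of `Node00.BetaOfRecord.beta0OfMerged`) equals `b_k` at EVERY base prefix — a last-slot
letter resolves the base-history ambiguity of `Negative/Anchor13FalseOfTwoBaseHistories` by FIAT, at the price of the rigidity above. [folklore] -/
theorem limUnder_lastSlot_eq {β : HBeta} {b : ℕ → ℝ} {ω : ℝ → ℝ} {γ₀ : ℝ} (hγ₀ : 0 < γ₀)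
    (hω : Tendsto ω (𝓝[>] 0) (𝓝 0)) (h : LastSlotLetter β b ω γ₀) (k : ℕ) (q : Fin (k + 1) → ℝ)
    (hq : ∀ i : Fin (k + 1), i ≠ Fin.last k → 0 < q i ∧ q i ≤ γ₀) :
    limUnder (𝓝[>] (0 : ℝ)) (fun t : ℝ => β k (Function.update q (Fin.last k) t)) = b k :=
  (lastSlot_tendsto_of_modulusLetter hγ₀ hω h k q hq).limUnder_eq

/-- The `BoxRemainder` instance of the rigidity display. [folklore] -/
theorem lastSlot_tendsto_of_boxRemainder {β : HBeta} {b : ℕ → ℝ} {Cr γ₀ : ℝ} (hγ₀ : 0 < γ₀) (h : BoxRemainder β b Cr γ₀)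
    (k : ℕ) (q : Fin (k + 1) → ℝ) (hq : ∀ i : Fin (k + 1), i ≠ Fin.last k → 0 < q i ∧ q i ≤ γ₀) :
    Tendsto (fun t : ℝ => β k (Function.update q (Fin.last k) t)) (𝓝[>] 0) (𝓝 (b k)) :=
  lastSlot_tendsto_of_modulusLetter hγ₀ (tendsto_linear_nhdsGT Cr) (lastSlotLetter_of_boxRemainder h) k q hq

/-! ## §2 Box-wide ∀k letters at a fixed level contain «one-loop running forever from a fixed bare coupling» -/

/-- The constant history `(γ₀, …, γ₀)` of length `k+1`: the honest flow's history from FIXED bare coupling `γ₀` with all GF weights `1/γ₀²`. [folklore] -/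
def constHist (γ₀ : ℝ) (k : ℕ) : Fin (k + 1) → ℝ := fun _ => γ₀

/-- It lies in the box `]0,γ₀]^{k+1}` at EVERY scale `k`. [folklore] -/
theorem constHist_mem_histBox {γ₀ : ℝ} (hγ₀ : 0 < γ₀) (k : ℕ) : constHist γ₀ k ∈ HistBox γ₀ k :=
  fun _ => ⟨hγ₀, le_rfl⟩

/-- **IR-CONTENT DISPLAY.**  A box-wide constant remainder `|β_{k+1} − b_k| ≤ s` on `]0,γ₀]^{k+1}` for ALL `k`, with the drift `|Σ_{j<k} b_j − slope·k| ≤ A`,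
forces the β-sums along the constant history from the FIXED bare coupling `γ₀` to grow at least linearly FOREVER:
`(slope − s)·k − A ≤ Σ_{j<k} β_{j+1}(γ₀,…,γ₀)` — one-loop running at every scale past the exit scale of `γ₀` (an infrared assertion; [I] Thm 3 p. 264
is about in-window run prefixes only). [cite: Balaban1987RG1, Thm 3 p.264 and (2.13) p.268] -/
theorem sum_constHist_ge_of_constRemainder_drift {β : HBeta} {b : ℕ → ℝ} {s γ₀ slope A : ℝ} (hγ₀ : 0 < γ₀)
    (hrem : ConstRemainder β b s γ₀) (hdrift : OneLoopDrift slope A b) (k : ℕ) :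
    (slope - s) * k - A ≤ ∑ j ∈ Finset.range k, β j (constHist γ₀ j) := by
  have h1 : ∀ j ∈ Finset.range k, b j - s ≤ β j (constHist γ₀ j) := fun j _ => by
    have := (abs_le.mp (hrem j _ (constHist_mem_histBox hγ₀ j))).1
    linarith
  have h2 : ∑ j ∈ Finset.range k, (b j - s) ≤ ∑ j ∈ Finset.range k, β j (constHist γ₀ j) := Finset.sum_le_sum h1
  have h3 : slope * k - A ≤ ∑ j ∈ Finset.range k, b j := by
    have := (abs_le.mp (hdrift k)).1
    linarith
  have h4 : ∑ j ∈ Finset.range k, (b j - s) = (∑ j ∈ Finset.range k, b j) - s * k := by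
    rw [Finset.sum_sub_distrib, Finset.sum_const, Finset.card_range, nsmul_eq_mul]; ring
  linarith

/-- … so with the seam `s < slope` the β-sums from the fixed bare coupling diverge to `+∞` (by the telescoped recursion (0.22)–(0.23) this is an
unbounded growth of the marginal coefficient at scales beyond the exit scale of `γ₀` — physically the opposite of a confining theory, and in any case
not a UV statement). [cite: Balaban1987RG1, (0.22)–(0.23) p.256 and Thm 3 p.264] -/
theorem tendsto_sum_constHist_atTop {β : HBeta} {b : ℕ → ℝ} {s γ₀ slope A : ℝ} (hγ₀ : 0 < γ₀)
    (hrem : ConstRemainder β b s γ₀) (hdrift : OneLoopDrift slope A b) (hs : s < slope) :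
    Tendsto (fun k : ℕ => ∑ j ∈ Finset.range k, β j (constHist γ₀ j)) atTop atTop := by
  have hlin : Tendsto (fun k : ℕ => (slope - s) * (k : ℝ) - A) atTop atTop := by
    have h := tendsto_natCast_atTop_atTop (R := ℝ)
    have h' := h.const_mul_atTop (sub_pos.mpr hs)
    exact tendsto_atTop_add_const_right _ (-A) h' |>.congr fun k => by ring
  exact tendsto_atTop_mono (fun k => sum_constHist_ge_of_constRemainder_drift hγ₀ hrem hdrift k) hlin

/-- The same display for a box-wide LOWER bound `0 < bpos ≤ β_{k+1}` (N24's `BetaLowerH bpos γ₀`, AF-0 box-wide): linear growth forever from the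
fixed bare coupling. [cite: Balaban1987RG1, Thm 2 p.259 and §1 p.264] -/
theorem sum_constHist_ge_of_betaLowerH {β : HBeta} {bpos γ₀ : ℝ} (hγ₀ : 0 < γ₀) (hlo : BetaLowerH bpos γ₀ β) (k : ℕ) :
    bpos * k ≤ ∑ j ∈ Finset.range k, β j (constHist γ₀ j) := by
  have h1 : ∀ j ∈ Finset.range k, bpos ≤ β j (constHist γ₀ j) := fun j _ =>
    hlo j _ (mem_box.mpr fun _ => ⟨hγ₀, le_rfl⟩)
  have h2 := Finset.sum_le_sum h1
  rw [mul_comm]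
  simpa [Finset.sum_const, Finset.card_range, nsmul_eq_mul] using h2

/-! ## §3 The UV-admissible re-keying: the modulus letter on IN-WINDOW RUN PREFIXES, (C)∕(U) on the SURVIVOR SETS (card ed. 2.2) -/

section Runs

/-- The Gaps survivor set at level `γ₁`, scale `k`: bare couplings `x ∈ ]0,γ₁]` whose clamped forward trajectory kept `1/ĝ_j² ≥ 1/γ₁²` up to `k`
(verbatim the set in `Gaps.EndSurvivorCensus`; ONE bare variable). [folklore] -/
def Surv (β : HBeta) (γ₁ : ℝ) (k : ℕ) : Set ℝ := {x : ℝ | 0 < x ∧ x ≤ γ₁ ∧ ∀ j, j ≤ k → 1 / γ₁ ^ 2 ≤ Y β γ₁ j x}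

/-- HYPOTHESIS SHAPE (run-keyed modulus clause): along every in-window run of (0.20) of level `γ₀`, `|β_{j+1}(g_0,…,g_j) − c·b_j| ≤ ω(g_j)` —
the last slot of a RUN prefix is the true coupling, so this is [I] Thm 3 + (2.13) read verbatim, with a modulus instead of a rate. [cite: Balaban1987RG1, Thm 3 p.264 and (2.13) p.268] -/
def ModOnRuns (β : HBeta) (b : ℕ → ℝ) (c : ℝ) (ω : ℝ → ℝ) (γ₀ : ℝ) : Prop :=
  ∀ (n : ℕ) (gs : ℕ → ℝ), RGEqH n β gs → Step.InInterval γ₀ n gs → ∀ j, j < n → |β j (prefixOf gs j) - c * b j| ≤ ω (gs j)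

/-- Run-keyed modulus restricts to lower levels. [folklore] -/
theorem modOnRuns_mono {β : HBeta} {b : ℕ → ℝ} {c : ℝ} {ω : ℝ → ℝ} {γ₀ γ₁ : ℝ} (h : ModOnRuns β b c ω γ₀) (hle : γ₁ ≤ γ₀) :
    ModOnRuns β b c ω γ₁ := fun n gs hrg hI j hj => h n gs hrg (inInterval_mono hI hle) j hj

/-- **RUN-WISE (PS) FROM DRIFT + RUN-KEYED MODULUS** (the seam chosen by the supplier, no certified constant): if the named numbers drift with slope
`slope > 0` and `0 < c`, then at some level `γ₁ ≤ γ₀` every in-window run has all its β-window-sums `≥ −2·c·A`. [cite: Balaban1987RG1, Thm 2 p.259 (first sentence) and (2.12)–(2.14) p.268] -/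
theorem runwisePS_of_drift_modOnRuns {β : HBeta} {b : ℕ → ℝ} {c slope A γ₀ : ℝ} {ω : ℝ → ℝ} (hγ₀ : 0 < γ₀) (hc : 0 < c)
    (hslope : 0 < slope) (hdrift : OneLoopDrift slope A b) (hω : Tendsto ω (𝓝[>] 0) (𝓝 0)) (hmod : ModOnRuns β b c ω γ₀) :
    ∃ γ₁ : ℝ, 0 < γ₁ ∧ γ₁ ≤ γ₀ ∧ ∀ (n : ℕ) (gs : ℕ → ℝ), RGEqH n β gs → Step.InInterval γ₁ n gs →
      ∀ k, k ≤ n → -(2 * c * A) ≤ ∑ j ∈ Finset.Ico k n, β j (prefixOf gs j) := by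
  obtain ⟨u, hu, hωu⟩ := exists_Ioo_of_tendsto hω (half_pos (mul_pos hc hslope))
  refine ⟨min γ₀ (u / 2), lt_min hγ₀ (half_pos hu), min_le_left _ _, fun n gs hrg hI k hkn => ?_⟩
  have hmod' := modOnRuns_mono hmod (min_le_left γ₀ (u / 2))
  have hterm : ∀ j ∈ Finset.Ico k n, c * b j - c * slope / 2 ≤ β j (prefixOf gs j) := by
    intro j hj
    have hjn : j < n := (Finset.mem_Ico.mp hj).2
    have hgj := hI j hjn.le
    have hωj : ω (gs j) < c * slope / 2 := hωu (gs j) hgj.1 (lt_of_le_of_lt hgj.2 (lt_of_le_of_lt (min_le_right _ _) (half_lt_self hu)))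
    have := (abs_le.mp (hmod' n gs hrg hI j hjn)).1
    linarith
  have hsum := Finset.sum_le_sum hterm
  have hd := sum_Ico_ge_of_drift hdrift hkn
  have hcard : ∑ j ∈ Finset.Ico k n, (c * b j - c * slope / 2) = c * (∑ j ∈ Finset.Ico k n, b j) - c * slope / 2 * ((n : ℝ) - k) := by
    rw [Finset.sum_sub_distrib, Finset.sum_const, Nat.card_Ico, nsmul_eq_mul, ← Finset.mul_sum, Nat.cast_sub hkn]; ring
  have hnk : (0 : ℝ) ≤ (n : ℝ) - k := by
    have : (k : ℝ) ≤ n := by exact_mod_cast hkn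
    linarith
  have hA := hdrift.nonneg
  nlinarith [hsum, hd, hcard, hnk, hc, hslope, mul_nonneg hc.le hnk]

variable (F : T4Family) (κ : StepColourData) (θ : Node00.Stage13HParams F 2) (hP : θ.Provisos₁₃SepCoPH F 2)

/-- **THE CARD'S CURRENCY, EDITION 2.2 (UV-admissible): the MODULUS PACKAGE ON RUNS ∕ SURVIVORS** at the record for the colour datum `κ`, normalisation
carried (`θ.cβ · beta0OfJs F κ j`).  (M) run-keyed modulus at some level `γ₀ ≤ θ.γ` with ONE `ω → 0`; (Cˢ)∕(Uˢ) the Gaps survivor letters — continuity of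
the one-variable trace and a per-scale bound on the survivor sets — at every level `γ₁ ≤ γ₀`.  No box-wide ∀k clause, no off-run last slot. [folklore] -/
def ModPkgOnRuns : Prop :=
  ∃ (γ₀ : ℝ) (ω : ℝ → ℝ), 0 < γ₀ ∧ γ₀ ≤ θ.γ ∧ Tendsto ω (𝓝[>] 0) (𝓝 0) ∧
    ModOnRuns (Node00.datumOfRecord₁₃SepCoPH F 2 θ hP).βfun (beta0OfJs F κ) θ.cβ ω γ₀ ∧
    (∀ γ₁ : ℝ, 0 < γ₁ → γ₁ ≤ γ₀ → ∀ k : ℕ,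
      ContinuousOn (fun x : ℝ => (Node00.datumOfRecord₁₃SepCoPH F 2 θ hP).βfun k
        (clampPrefix (Node00.datumOfRecord₁₃SepCoPH F 2 θ hP).βfun γ₁ k x)) (Surv (Node00.datumOfRecord₁₃SepCoPH F 2 θ hP).βfun γ₁ k)) ∧
    (∀ γ₁ : ℝ, 0 < γ₁ → γ₁ ≤ γ₀ → ∀ k : ℕ, ∃ B : ℝ, ∀ x : ℝ, 0 < x → x ≤ γ₁ →
      (∀ j, j ≤ k → 1 / γ₁ ^ 2 ≤ Y (Node00.datumOfRecord₁₃SepCoPH F 2 θ hP).βfun γ₁ j x) →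
      (Node00.datumOfRecord₁₃SepCoPH F 2 θ hP).βfun k (clampPrefix (Node00.datumOfRecord₁₃SepCoPH F 2 θ hP).βfun γ₁ k x) ≤ B)

/-- `0 < θ.cβ` at an admissible Stage-13 tuple (the Stage-9 chart clause). [folklore] -/
theorem cβ_pos_of_admissible₁₃ {F : T4Family} {θ : Node00.Stage13HParams F 2} (hθ : θ.Admissible F 2) : 0 < θ.cβ :=
  hθ.toStage12.toStage9.chart.1

/-- The T⁴ family's block has `1 < L`: `0 < stepBal 2 F.L`. [folklore] -/
theorem stepBal_two_pos : 0 < B12Normalization.stepBal 2 (F.L : ℝ) :=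
  B12Normalization.stepBal_pos (by norm_num) (by exact_mod_cast F.hL.2)

variable {F κ θ hP}

/-- **END OF THE RECORD DATUM FROM (D1)-DRIFT + THE RUN-KEYED MODULUS PACKAGE**, through the tree's survivor-letter road
`Gaps.EndSurvivorCensus.endpointExistence_datum_of_survivorLetters_runwisePS` BY NAME. [cite: Balaban1987RG1, Thm 2 p.259 (first sentence) and (0.20) p.256] -/
theorem endpoint_of_drift_modPkgOnRuns (hθ : θ.Admissible F 2) {A : ℝ}
    (hdrift : OneLoopDrift (B12Normalization.stepBal 2 F.L) A (beta0OfJs F κ)) (hpkg : ModPkgOnRuns F κ θ hP) :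
    EndpointExistence (Node00.datumOfRecord₁₃SepCoPH F 2 θ hP).C.toB12 := by
  obtain ⟨γ₀, ω, hγ₀, _hγθ, hω, hmod, hsc, hsl⟩ := hpkg
  have hc := cβ_pos_of_admissible₁₃ hθ
  obtain ⟨γ₁, hγ₁, hγ₁₀, hrun⟩ := runwisePS_of_drift_modOnRuns hγ₀ hc (stepBal_two_pos F) hdrift hω hmod
  have hM : 0 ≤ 2 * θ.cβ * A := by have := hdrift.nonneg; positivity
  exact endpointExistence_datum_of_survivorLetters_runwisePS (Node00.datumOfRecord₁₃SepCoPH F 2 θ hP) hγ₁ hM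
    (hsc γ₁ hγ₁ hγ₁₀) (hsl γ₁ hγ₁ hγ₁₀) hrun

/-- Stub 2ᴹᴿ (edition 2.2): at every proviso-carrying admissible Stage-13 tuple SOME colour datum's normalised one-loop numbers shadow the β of record
to modulus grade ALONG IN-WINDOW RUNS, with the survivor letters. [folklore] -/
def ModulusOnRunsAtJets13 : Prop :=
  ∀ (F : T4Family) (θ : Node00.Stage13HParams F 2) (hP : θ.Provisos₁₃SepCoPH F 2), θ.Admissible F 2 → ∃ κ : StepColourData, ModPkgOnRuns F κ θ hP

/-- Stub 1ᴹᴿ (edition 2.2) = row (D1) keyed on the run package: the NAMED numbers drift with the bare slope `stepBal 2 F.L`. [folklore] -/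
def D1AtModRunsJets13 : Prop :=
  ∀ (F : T4Family) (κ : StepColourData) (θ : Node00.Stage13HParams F 2) (hP : θ.Provisos₁₃SepCoPH F 2), θ.Admissible F 2 →
    ModPkgOnRuns F κ θ hP → ∃ A : ℝ, OneLoopDrift (B12Normalization.stepBal 2 F.L) A (beta0OfJs F κ)

/-- **THE COMPOSITION, EDITION 2.2, kernel-checked: the crux decl BY NAME from the two run-keyed stub texts.** [cite: Balaban1987RG1, Thm 2 p.259 (first sentence) and (5.10) p.293] -/
theorem EndpointGivenBR13SepCoPH_of_line1ModRuns (h₁ : D1AtModRunsJets13) (h₂ : ModulusOnRunsAtJets13) :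
    Summit.QuantumFields.YangMills.Theses.BalabanUVNodes.EndpointGivenBR13SepCoPH := by
  intro F θ hP _hU hθ _hB _hwin
  obtain ⟨κ, hpkg⟩ := h₂ F θ hP hθ
  obtain ⟨A, hdrift⟩ := h₁ F κ θ hP hθ hpkg
  exact endpoint_of_drift_modPkgOnRuns hθ hdrift hpkg

end Runs

end Summit.QuantumFields.YangMills.Cruxes.EndpointGivenBR13SepCoPH.Idea5GaugeSlot

end
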